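import Summits.Ventures.PackingBounds.ThreePointCert.CheckExact

/-!
# Kernel checker for exact three-point certificates: pre-multiplied summands of `(ii)`

Framing: lottery ticket; floor = certified bounds/negative ranges. Venture `PackingBounds`
(cell `pub-packcert`), three-point SDP family.

`ThreePointCert.CheckExact.checkIIX` multiplies the four totals `TOT_1 … TOT_4` by their multiplier
polynomials `m_1, m_2, m_3, s_4` inside one `decide`; at degree 10 this is ~5·10⁴ term products on
300-bit coefficients, close to the kernel's per-declaration memory bound on the smaller farm nodes.
Here each product is validated separately (`mulOK`: `P_i ≡ m_i · (κ_i · TOT_i)`, one kernel `decide`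
each) and the identity of `(ii)` is then checked on the pre-multiplied summands (`checkIIX2`).
Soundness (`FX_nonpos_of_check2`) is in `ThreePointCert.SoundExactChecks`.
-/

noncomputable section

namespace Summit.Ventures.PackingBounds.ThreePointCert

open Literature.Geometry.DiscreteGeometry Literature.Geometry.DiscreteGeometry.PolyCert
open Literature.Geometry.DiscreteGeometry.PolyCert.SPoly

/-- Pre-multiplication check: `P ≡ m · (κ · T)` as term lists (trie-free zero test). -/
def mulOK (m : SPoly) (κ : ℕ) (T P : SPoly) : Bool :=
  allZero (mergeAll [mulN m (smul (κ : ℤ) T), neg P])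

/-- Check of `(ii)` on pre-multiplied summands:
`κ_F FP + κ_0 TOT_0 + P_1 + P_2 + P_3 + P_4 ≡ 0`, where `P_i ≡ m_i · (κ_i · TOT_i)` (`mulOK`). -/
def checkIIX2 (c : CertX) (P : PolysX) (P1 P2 P3 P4 : SPoly) : Bool :=
  decide (0 < c.kF) && decide (P.TOT.length = 5) && decide (c.kR.length = 5) &&
  allZero (mergeAll [smul (c.kF : ℤ) P.FP, smul (c.kR.getD 0 0 : ℤ) (P.TOT.getD 0 []), P1, P2, P3, P4])

end Summit.Ventures.PackingBounds.ThreePointCert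

end
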